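/-
Copyright (c) 2026 the pub-hodgecm-mathlib formalisation cell (harness21).  Prover seat hodgecm-mathlib-LH10-p01 (g11): road M6 → F3 → F5 (LEAD F0P3a-plan T15-32 «GO-LOW»),
brick (B2b-II) «THE 2-FREE CLASS TOTALS AT A FRAME» for the (B3) F5 head of LH7-p04 (g12); 2026-09-03.
-/
import Literature.NumberTheory.Rogawski1990.DepthZeroKappaTransferTypeTwoStrataTotalPlaceCount   -- ★ (B2b-I) p853318: `sum_ncard_rankStrata_eq_ncard_isSelfDualLattice_stable_of_frame`
import Literature.NumberTheory.Rogawski1990.SelfDualStableLatticeCountInertPlace                  -- ★ F5-(0) p853304 (LH4-p01): `ncard_isSelfDualLattice_stable_eq_phiTHn_inertPlace ∕ _phiTHprimen_inertPlace`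
import Literature.NumberTheory.Rogawski1990.EndoscopicBlockFrameAlgHom                             -- ★ (O-5)-place: `exists_algHom_blockFrame_apply_eq_of_conj_place`
import Literature.NumberTheory.Rogawski1990.UnitOrbitalIntegralInertValueTHOfKappa                 -- ★ B-p12: the κ-reading kit (`exists_toLocalRing_eq_formValue`, `finKappaAt_eq_ite_even_of_nonsplit_of_isUnramifiedIn`, `sum_map_mulVec_mul_mulVec_eq_of_formCongr_eq`, `conjLocal_apply_eq_galAdicCompletionMap`)
import Literature.NumberTheory.Rogawski1990.FinExplicitTransferFactorKappaOddEigenline             -- ★ B-p14: `twistGram_apply_self_eq_formValue` (+ `mulVec_col_eq_smul_of_blockFrame`, `blockFrame_apply_corner`, `twistGram_blockFrame_eq`, `blockFrame_gram_hermitian`)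
import Literature.NumberTheory.Automorphic.UnitaryGroupIwasawaFiniteAdelic                          -- ★ `isUnit_placeForm_antidiagonal_unit_mem_glInt`, `placeForm_antidiagonal`
import Literature.NumberTheory.Weil1982.UnitaryLocalRingBaseField                                   -- ★ `exists_complexConj_eq_neg_ne_zero`
import HarnessLib

/-!
# The 2-free class totals of a depth-zero type-(2) match at an integral frame of the inert place (★ (B2b-I) ∘ ★ F5-(0), the form, the block frame and the class token discharged)

Topic `NumberTheory/Rogawski1990`; namespace `Literature.NumberTheory.Rogawski1990`.  THEOREMS ONLY (no definition, no instance, no notation, no named fact, no `sorry`);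
kernel lane `--supports stmt-HodgeConjecture-24833`.  Cell `pub/hodgecm-mathlib` (D-0151), crux H413 = `stmt-HodgeConjecture-24833`; road M6 → F3 → F5 «2-free type-(2) G-side head»
(LEAD F0P3a-plan T15-32 «GO-LOW»), brick **(B2b-II) «CLASS TOTALS AT A FRAME»** feeding the (B3) F5 head `finsum_finExplicitDelta_mul_classOrbitalIntegral_depthZero_eq_of_eisensteinData`
of LH7-p04 (g12) (its placeholders `hTp ∕ hTm`).  HONEST LABEL: HC_CM is proved only modulo the 7 printed citations (2 remaining named inputs: hLiu418 = stmt-HodgeConjecture-24832,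
h413 = stmt-HodgeConjecture-24833) until rung 0 closes; count-neutral assembly of ★ bricks (pays no organ; zero label movement until F5 ★ and a desk-priced rider).

THE MATHEMATICS.  For a deep match `δ` of a `G`-regular type-(2) `γ_H = (g, u)` at an inert place `w ∣ v` (unramified, ANY residue characteristic), with block frame `c`
(`c·ι_v(γ_H)·c⁻¹ = δ`) and an integral frame `T` of `H′_w` (`H′_w = ᵗ(σ_wT)·J₀·T`), ★ (B2b-I) gives `n₀(δ) + n₁(δ) + n₂(δ) = #{M J₀-self-dual, (Tδ_wT⁻¹)M ⊆ M}`, and `Tδ_wT⁻¹ =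
φ_b(g_w, u_w)` for the block-frame algebra map at `c_fr = T·c_w` (★ (O-5)-place); ★ F5-(0) evaluates the count as `phiTHn q n N` (class I) ∕ `phiTHprimen q n N` (class II), the
class being the token «`⟨c_fr e₃, c_fr e₃⟩_{J₀}·z·σz` is a unit for some `z`».  Since `c_fr e₃ = T(c e₃)_w` with `c e₃` a `u`-eigenvector of `δ` (★ B-p14), `⟨c_fr e₃, c_fr e₃⟩_{J₀} =
ι_w x₀` for the `H′_v`-value `x₀ ∈ L⁺_v` of `c e₃` (★ B-p12), and ★ `finKappaAt_eq_ite_even_of_nonsplit_of_isUnramifiedIn` reads `κ_v(γ_H, δ) = +1 ⟺ ord_v x₀` even ⟺ the token.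
What REMAINS a binder is ★ F5-(0)'s row-∕pair-level block (θ-package `M w₁ aF k₀ θ s̃ …`, endoscopic frame `φ hφ hstar`, pair letters `λ hφx hK hall hcoordλ P hP hPx`, gate `hgateV`)
— LH4-p01's (B2d) discharges it per row — with the (B3) head's Eisenstein letters `ϖ Θ α β a b n N hg1 hu1` and the class sign `hκ`.
[cite: Rogawski1990, §4.9 Lemma 4.9.3 p. 56, Prop. 4.9.1 (b) p. 55; §4.8 Case (a) p. 53] [cite: Kottwitz1986BaseChangeUnits, §1 pp. 240–241] [cite: Flicker1998UnitaryFL, Prop. 11 p. 87, Props. 16–17 pp. 96–97, Theorem 18 p. 97]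

* `exists_ne_zero_and_valuation_sq_mul_eq_one_iff_even_log` (§1, the parity lemma);
* **`sum_ncard_rankStrata_eq_phiTHn_of_frame_of_finKappaAt_eq_one`** (class I), **`sum_ncard_rankStrata_eq_phiTHprimen_of_frame_of_finKappaAt_eq_neg_one`** (class II).

## References
* [Rogawski1990] J. D. Rogawski, *Automorphic Representations of Unitary Groups in Three Variables*, Ann. of Math. Stud. 123 (1990): §4.9 Lemma 4.9.3 p. 56, Prop. 4.9.1 (b) p. 55; §4.8 p. 53.
* [Kottwitz1986BaseChangeUnits] R. E. Kottwitz, *Base change for unit elements of Hecke algebras*, Compositio Math. 60 (1986): §1 pp. 240–241.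
* [Flicker1998UnitaryFL] Y. Z. Flicker, *Elementary proof of the fundamental lemma for a unitary group*, Canad. J. Math. 50 (1998): Prop. 11 p. 87, Props. 16–17, Theorem 18 p. 97.
-/

set_option autoImplicit false

noncomputable section

open NumberField IsDedekindDomain Matrix Polynomial ValuativeRel
open scoped MatrixGroups WithZero ValuativeRel

namespace Literature.NumberTheory.Rogawski1990

open Literature.NumberTheory.Automorphic Literature.NumberTheory.Automorphic.UnitaryGroup Literature.NumberTheory.Automorphic.IntegralReduction
open Literature.NumberTheory.Automorphic.UnitaryLatticeTree Literature.NumberTheory.Automorphic.HermitianLattice Literature.NumberTheory.GaloisRepresentations Literature.NumberTheory.NumberFields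
open Literature.NumberTheory.Rogawski1990.Flicker1998 (phiTHn phiTHprimen)

/-- **`∃ z ≠ 0, |z|²·X = 1 ⟺ log X even`** for a non-zero value `X ∈ ℤᵐ⁰` in a valued field holding an element `ϖ` of valuation `exp(−1)`. [cite: SerreLocalFields1979, Ch. II §1] -/
theorem exists_ne_zero_and_valuation_sq_mul_eq_one_iff_even_log {K : Type*} [Field K] [Valued K ℤᵐ⁰] {ϖ : K} (hϖ : Valued.v ϖ = WithZero.exp (-1 : ℤ))
    {X : ℤᵐ⁰} (hX : X ≠ 0) :
    (∃ z : K, z ≠ 0 ∧ Valued.v z ^ 2 * X = 1) ↔ Even (WithZero.log X) := by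
  have hϖ0 : ϖ ≠ 0 := fun h0 => by rw [h0, map_zero] at hϖ; exact WithZero.coe_ne_zero hϖ.symm
  constructor
  · rintro ⟨z, hz0, hz⟩
    have hvz0 : Valued.v z ≠ 0 := (Valuation.ne_zero_iff _).2 hz0
    have hlog := congrArg WithZero.log hz
    rw [WithZero.log_mul (pow_ne_zero _ hvz0) hX, WithZero.log_pow, WithZero.log_one, two_nsmul] at hlog
    exact ⟨-WithZero.log (Valued.v z), by linarith⟩
  · rintro ⟨m, hm⟩
    refine ⟨ϖ ^ m, zpow_ne_zero _ hϖ0, ?_⟩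
    rw [map_zpow₀, hϖ, ← WithZero.exp_zsmul, ← WithZero.exp_log hX, hm, ← WithZero.exp_nsmul, ← WithZero.exp_add, ← WithZero.exp_zero]
    congr 1; simp only [smul_eq_mul, nsmul_eq_mul]; push_cast; ring

variable (L : Type) [Field L] [NumberField L] [IsCMField L] (H' : Matrix (Fin 3) (Fin 3) L)
  {v : HeightOneSpectrum (𝓞 ↥(maximalRealSubfield L))}

section Frame

variable {L H'}
  (hH' : (H'.map (IsCMField.complexConj L))ᵀ = H') (w : PlacesOver L v)
  (hw : IsCMField.complexConj L • w.1 = w.1) (hv : Algebra.IsUnramifiedIn (𝓞 L) v.asIdeal) (hH'u : IsUnit H')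
  {γH : (cmDatum L 2 (Matrix.of fun i j : Fin 2 => if i.val + j.val + 1 = 2 then (1 : L) else 0)).Local v ×
    (cmDatum L 1 (Matrix.of fun i j : Fin 1 => if i.val + j.val + 1 = 1 then (1 : L) else 0)).Local v}
  (hreg : IsLocalGRegular L v γH)
  (hirr : ¬ ∃ x : w.1.adicCompletion L, (((γH.1.val : GL (Fin 2) (LocalRing L v)).val.map
      (Pi.evalRingHom (fun w' : PlacesOver L v => w'.1.adicCompletion L) w)).charpoly).IsRoot x)
  (δ : (cmDatum L 3 H').Local v) (h : IsLocalNormPair L H' v γH δ)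
  (ht : ∀ m : ℕ, ValuativeRel.valuation (w.1.adicCompletion L)
    (((((δ.val : GL (Fin 3) (LocalRing L v)).val.map (Pi.evalRingHom (fun w' : UnitaryGroup.PlacesOver L v => w'.1.adicCompletion L) w))).charpoly -
      (Polynomial.X - 1) ^ 3).coeff m) < 1)
  {cj : GL (Fin 3) (LocalRing L v)}
  (hcj : cj * ((endoEmbLocal L v γH).val : GL (Fin 3) (LocalRing L v)) * cj⁻¹ = (δ.val : GL (Fin 3) (LocalRing L v)))
  (T : GL (Fin 3) (w.1.adicCompletion L)) (hTint : T ∈ glInt 3 (w.1.adicCompletion L))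
  (hJT : placeForm H' w.1 = formCongr (galAdicCompletionMap (L := L) (IsCMField.complexConj L) hw) T ((StdForm.antidiagonal 3).over (w.1.adicCompletion L)))
  -- ★ F5-(0)'s θ-package of the row (`F := L⁺`, `E := L`, `c := complexConj`)
  {M : Type} [Field M] [NumberField M] [Algebra L M] (w₁ : PlacesOver M w.1)
  {aF k₀ : v.adicCompletion ↥(maximalRealSubfield L)} (haF : Valued.v aF < 1) (hk₀ : Valued.v k₀ = WithZero.exp (-1 : ℤ))
  {θ : w₁.1.adicCompletion M} (s' : w₁.1.adicCompletion M →+* w₁.1.adicCompletion M)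
  (hθ : θ ^ 2 = toPlace w.1 w₁ (toPlace v w aF) * θ + toPlace w.1 w₁ (toPlace v w k₀)) (hθv : Valued.v θ = WithZero.exp (-1 : ℤ))
  (hcoord : ∀ z : w₁.1.adicCompletion M, ∃! pq : w.1.adicCompletion L × w.1.adicCompletion L, z = toPlace w.1 w₁ pq.1 + toPlace w.1 w₁ pq.2 * θ)
  (hint : ∀ p q : w.1.adicCompletion L, toPlace w.1 w₁ p + toPlace w.1 w₁ q * θ ∈ 𝒪[w₁.1.adicCompletion M] ↔ p ∈ 𝒪[w.1.adicCompletion L] ∧ q ∈ 𝒪[w.1.adicCompletion L])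
  (hs'ι : ∀ x, s' (toPlace w.1 w₁ x) = toPlace w.1 w₁ (galAdicCompletionMap (L := L) (IsCMField.complexConj L) hw x)) (hs'θ : s' θ = θ) (hs's' : ∀ z, s' (s' z) = z)
  (hs'O : ∀ z : 𝒪[w₁.1.adicCompletion M], s' z ∈ 𝒪[w₁.1.adicCompletion M]) (hs'v : ∀ z, Valued.v (s' z) = Valued.v z)
  (hnorm1 : ∀ c₁ : w₁.1.adicCompletion M, c₁ ≠ 0 → s' c₁ = c₁ → Even (WithZero.log (Valued.v c₁)) → ∃ a : w₁.1.adicCompletion M, a * s' a * c₁ = 1)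
  -- the block frame `c_fr = T · c_w` and its algebra map (★ `exists_algHom_blockFrame`)
  (cfr : GL (Fin 3) (w.1.adicCompletion L))
  (hcfr : (cfr : Matrix (Fin 3) (Fin 3) (w.1.adicCompletion L)) = (T : Matrix (Fin 3) (Fin 3) (w.1.adicCompletion L)) *
    ((cj : GL (Fin 3) (LocalRing L v)) : Matrix (Fin 3) (Fin 3) (LocalRing L v)).map (Pi.evalRingHom (fun w' : PlacesOver L v => w'.1.adicCompletion L) w))
  (φb : (Matrix (Fin 2) (Fin 2) (w.1.adicCompletion L) × w.1.adicCompletion L) →ₐ[w.1.adicCompletion L] Matrix (Fin 3) (Fin 3) (w.1.adicCompletion L))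
  (hφb : ∀ (g : Matrix (Fin 2) (Fin 2) (w.1.adicCompletion L)) (u : w.1.adicCompletion L),
    φb (g, u) = (cfr : Matrix (Fin 3) (Fin 3) (w.1.adicCompletion L)) *
      Matrix.reindex endoPerm endoPerm (Matrix.fromBlocks g 0 0 (u • (1 : Matrix (Fin 1) (Fin 1) (w.1.adicCompletion L)))) *
      ((cfr⁻¹ : GL (Fin 3) (w.1.adicCompletion L)) : Matrix (Fin 3) (Fin 3) (w.1.adicCompletion L)))
  (φ : (w.1.adicCompletion L × w₁.1.adicCompletion M) →ₐ[w.1.adicCompletion L] Matrix (Fin 3) (Fin 3) (w.1.adicCompletion L)) (hφ : Function.Injective φ)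
  (hstar : ∀ b : w.1.adicCompletion L × w₁.1.adicCompletion M, (StdForm.antidiagonal 3).over (w.1.adicCompletion L) *
    φ (RingHom.prodMap (galAdicCompletionMap (L := L) (IsCMField.complexConj L) hw) s' b) =
      ((φ b).map (galAdicCompletionMap (L := L) (IsCMField.complexConj L) hw))ᵀ * (StdForm.antidiagonal 3).over (w.1.adicCompletion L))
  -- the Eisenstein block of the (B3) head (★ F2 `exists_eisensteinData` ∕ ★ (W1)'s letters, `ϖ`-currency)
  {ϖ : w.1.adicCompletion L} (hϖ : Valued.v ϖ = WithZero.exp (-1 : ℤ))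
  {Θ : Matrix (Fin 2) (Fin 2) (w.1.adicCompletion L)} {α β a b : w.1.adicCompletion L}
  (hΘ : Θ = α • (1 : Matrix (Fin 2) (Fin 2) (w.1.adicCompletion L)) +
    β • ((γH.1.val : GL (Fin 2) (LocalRing L v)).val.map (Pi.evalRingHom (fun w' : PlacesOver L v => w'.1.adicCompletion L) w)))
  (hΘd : Valued.v Θ.det = Valued.v ϖ) (hΘt : Valued.v Θ.trace < 1)
  (hrel : finGammaTwo L v γH w • (1 : Matrix (Fin 2) (Fin 2) (w.1.adicCompletion L)) -
      (γH.1.val : GL (Fin 2) (LocalRing L v)).val.map (Pi.evalRingHom (fun w' : PlacesOver L v => w'.1.adicCompletion L) w) =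
    a • (1 : Matrix (Fin 2) (Fin 2) (w.1.adicCompletion L)) + b • Θ)
  (n N : ℕ) (hn : Valued.v (((finCharpolyTwo L v γH).eval (finGammaTwo L v γH)) w) = WithZero.exp (-(n : ℤ)))
  (hb : Valued.v b = Valued.v ϖ ^ N)
  (hg1 : ∀ i j, Valued.v ((((γH.1.val : GL (Fin 2) (LocalRing L v)).val.map (Pi.evalRingHom (fun w' : PlacesOver L v => w'.1.adicCompletion L) w)) - 1) i j) ≤
    WithZero.exp (-1 : ℤ))
  (hu1 : Valued.v (finGammaTwo L v γH w - 1) ≤ WithZero.exp (-1 : ℤ))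
  -- ★ F5-(0)'s pair letters: a root `λ ∈ M_{w₁}` of `χ_{g_w}`, `φ(u_w, λ) = φ_b(g_w, u_w)`, the Krylov unit, generation, coordinates, the ⋆-polynomial
  {lam : w₁.1.adicCompletion M}
  (hlam : lam ^ 2 - toPlace w.1 w₁ ((γH.1.val : GL (Fin 2) (LocalRing L v)).val.map (Pi.evalRingHom (fun w' : PlacesOver L v => w'.1.adicCompletion L) w)).trace * lam +
    toPlace w.1 w₁ ((γH.1.val : GL (Fin 2) (LocalRing L v)).val.map (Pi.evalRingHom (fun w' : PlacesOver L v => w'.1.adicCompletion L) w)).det = 0)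
  (hφx : φ ((finGammaTwo L v γH w, lam) : w.1.adicCompletion L × w₁.1.adicCompletion M) =
    φb (((γH.1.val : GL (Fin 2) (LocalRing L v)).val.map (Pi.evalRingHom (fun w' : PlacesOver L v => w'.1.adicCompletion L) w)), finGammaTwo L v γH w))
  (hK : IsUnit (Matrix.of fun i j : Fin 3 =>
    (((φb (((γH.1.val : GL (Fin 2) (LocalRing L v)).val.map (Pi.evalRingHom (fun w' : PlacesOver L v => w'.1.adicCompletion L) w)), finGammaTwo L v γH w)) ^ (j : ℕ)) *ᵥ
      ((cfr : Matrix (Fin 3) (Fin 3) (w.1.adicCompletion L)) *ᵥ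
        (Pi.single (endoPerm (Sum.inl 0)) (1 : w.1.adicCompletion L) + Pi.single (endoPerm (Sum.inr 0)) (1 : w.1.adicCompletion L)))) i).det)
  (hall : ∀ x : w.1.adicCompletion L × w₁.1.adicCompletion M, ∃ Q : (w.1.adicCompletion L)[X],
    aeval ((finGammaTwo L v γH w, lam) : w.1.adicCompletion L × w₁.1.adicCompletion M) Q = x)
  (hcoordlam : ∀ z : w₁.1.adicCompletion M, ∃ p q : w.1.adicCompletion L, z = toPlace w.1 w₁ p + toPlace w.1 w₁ q * lam)
  (P : (w.1.adicCompletion L)[X]) (hP : ∀ i, P.coeff i ∈ 𝒪[w.1.adicCompletion L])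
  (hPx : aeval ((finGammaTwo L v γH w, lam) : w.1.adicCompletion L × w₁.1.adicCompletion M) P =
    (galAdicCompletionMap (L := L) (IsCMField.complexConj L) hw (finGammaTwo L v γH w), s' lam))
  (hgateV : ∀ (u' p' q' t' D' : w.1.adicCompletion L) (N'' b' : ℕ),
    ((u', toPlace w.1 w₁ p' + toPlace w.1 w₁ q' * θ) : w.1.adicCompletion L × w₁.1.adicCompletion M) *
      RingHom.prodMap (galAdicCompletionMap (L := L) (IsCMField.complexConj L) hw) s'
        ((u', toPlace w.1 w₁ p' + toPlace w.1 w₁ q' * θ) : w.1.adicCompletion L × w₁.1.adicCompletion M) = 1 →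
    Valued.v (u' - 1) < 1 → Valued.v (p' - 1) < 1 → Valued.v q' = WithZero.exp (-(N'' : ℤ)) →
    (toPlace w.1 w₁ p' + toPlace w.1 w₁ q' * θ) ^ 2 - toPlace w.1 w₁ t' * (toPlace w.1 w₁ p' + toPlace w.1 w₁ q' * θ) + toPlace w.1 w₁ D' = 0 →
    Valued.v (u' * u' - t' * u' + D') = WithZero.exp (-(b' : ℤ)) →
    ((∃ x : Fin 3 → w.1.adicCompletion L, ∃ g₁ ∈ unitaryGroupOfForm (galAdicCompletionMap (L := L) (IsCMField.complexConj L) hw)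
        ((StdForm.antidiagonal 3).over (w.1.adicCompletion L)),
      Submodule.span 𝒪[w.1.adicCompletion L] (Set.range fun k : Fin 3 =>
        ((φ ((u', toPlace w.1 w₁ p' + toPlace w.1 w₁ q' * θ) : w.1.adicCompletion L × w₁.1.adicCompletion M)) ^ (k : ℕ)) *ᵥ x) =
        Submodule.span 𝒪[w.1.adicCompletion L] (Set.range ((g₁ : Matrix (Fin 3) (Fin 3) (w.1.adicCompletion L)))ᵀ)) ↔
    Even (WithZero.log (Valued.v (∑ k, ∑ i,
      galAdicCompletionMap (L := L) (IsCMField.complexConj L) hw (((cfr : Matrix (Fin 3) (Fin 3) (w.1.adicCompletion L)) *ᵥ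
        Pi.single (endoPerm (Sum.inr 0)) (1 : w.1.adicCompletion L)) i) *
      (StdForm.antidiagonal 3).over (w.1.adicCompletion L) i k *
      ((cfr : Matrix (Fin 3) (Fin 3) (w.1.adicCompletion L)) *ᵥ Pi.single (endoPerm (Sum.inr 0)) (1 : w.1.adicCompletion L)) k)) + b')))

set_option synthInstance.maxHeartbeats 200000 in
set_option maxHeartbeats 1600000 in
-- the strata sets, the lattice sets and ★ F5-(0)'s ≈ 50-binder instantiation are large terms (★ `…UnitRow` ∕ ★ GSide budgets)
include hH' hv hH'u hreg hirr h ht hcj hTint hJT haF hk₀ hθ hθv hcoord hint hs'ι hs'θ hs's' hs'O hs'v hnorm1 hcfr hφb hφ hstar hϖ hΘ hΘd hΘt hrel hn hb hg1 hu1 hlam hφx hK hall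
  hcoordlam hP hPx hgateV in
open scoped Classical in
/-- **THE KEY STEP (both classes)**: the class total is ★ F5-(0)'s lattice count at `J₀`, `c_fr`, and the class-I token at `c_fr e₃` holds iff `κ_v(γ_H, δ) = 1`.
[cite: Rogawski1990, §4.9 Lemma 4.9.3 p. 56, Prop. 4.9.1 (b) p. 55] [cite: Flicker1998UnitaryFL, Prop. 11 p. 87, Props. 16–17 pp. 96–97] -/
private theorem sum_ncard_rankStrata_eq_and_token_iff :
    (({q : (cmDatum L 3 H').Local v ⧸ cmLocalIntegralLevel L 3 H' v |
            q ∈ MulAction.fixedBy ((cmDatum L 3 H').Local v ⧸ cmLocalIntegralLevel L 3 H' v) δ ∧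
              (redMat ((((q.out⁻¹ * δ * q.out : (cmDatum L 3 H').Local v)).val : GL (Fin 3) (LocalRing L v)).val.map
                (Pi.evalRingHom (fun w' : UnitaryGroup.PlacesOver L v => w'.1.adicCompletion L) w)) - 1).rank = 0}.ncard +
        {q : (cmDatum L 3 H').Local v ⧸ cmLocalIntegralLevel L 3 H' v |
            q ∈ MulAction.fixedBy ((cmDatum L 3 H').Local v ⧸ cmLocalIntegralLevel L 3 H' v) δ ∧
              (redMat ((((q.out⁻¹ * δ * q.out : (cmDatum L 3 H').Local v)).val : GL (Fin 3) (LocalRing L v)).val.map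
                (Pi.evalRingHom (fun w' : UnitaryGroup.PlacesOver L v => w'.1.adicCompletion L) w)) - 1).rank = 1}.ncard +
        {q : (cmDatum L 3 H').Local v ⧸ cmLocalIntegralLevel L 3 H' v |
            q ∈ MulAction.fixedBy ((cmDatum L 3 H').Local v ⧸ cmLocalIntegralLevel L 3 H' v) δ ∧
              (redMat ((((q.out⁻¹ * δ * q.out : (cmDatum L 3 H').Local v)).val : GL (Fin 3) (LocalRing L v)).val.map
                (Pi.evalRingHom (fun w' : UnitaryGroup.PlacesOver L v => w'.1.adicCompletion L) w)) - 1).rank = 2}.ncard : ℕ) : ℚ) =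
      (if finKappaAt L v H' γH δ = 1 then phiTHn (Nat.card 𝓀[v.adicCompletion ↥(maximalRealSubfield L)]) n N
        else phiTHprimen (Nat.card 𝓀[v.adicCompletion ↥(maximalRealSubfield L)]) n N) := by
  classical
  have hc1 : IsCMField.complexConj L ≠ 1 := IsCMField.complexConj_ne_one L
  haveI : Algebra.IsQuadraticExtension ↥(maximalRealSubfield L) L := IsCMField.isQuadraticExtension L
  set σ : w.1.adicCompletion L →+* w.1.adicCompletion L := galAdicCompletionMap (L := L) (IsCMField.complexConj L) hw with hσdef
  set ev := Pi.evalRingHom (fun w' : PlacesOver L v => w'.1.adicCompletion L) w with hev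
  have hσσ : ∀ x, σ (σ x) = x := galAdicCompletionMap_galAdicCompletionMap_of_smul_eq (IsCMField.complexConj L) w hc1 hw
  have hvσ : ∀ x, Valued.v (σ x) = Valued.v x := fun x => valued_galAdicCompletionMap (L := L) (IsCMField.complexConj L) hw x
  have hιv : ∀ y : v.adicCompletion ↥(maximalRealSubfield L), Valued.v (toPlace v w y) = Valued.v y :=
    fun y => Literature.NumberTheory.Automorphic.Liu2021.LemD1IndexedNonVacuityInertCofinite.valued_toPlace_of_isUnramifiedIn L v hv w y
  have hϖk : Valued.v (toPlace v w k₀) = WithZero.exp (-1 : ℤ) := by rw [hιv, hk₀]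
  -- ### (1) ★ (B2b-I) at `ϖ := ι_w k₀`: the class total is the `J₀`-lattice count at `T δ_w T⁻¹`
  have htot := sum_ncard_rankStrata_eq_ncard_isSelfDualLattice_stable_of_frame L H' hH' w hw hv hH'u hreg hirr δ h ht T hTint hJT hϖk
  -- ### (2) the form `J₀` as a unit: integral, hermitian, `L₀` self-dual, transitivity (2-free)
  have hΦw : IsUnit (placeForm ((StdForm.antidiagonal 3).over L) w.1) := by
    rw [placeForm_antidiagonal]; exact (StdForm.antidiagonal 3).isUnit_over _
  have hJ : hΦw.unit ∈ glInt 3 (w.1.adicCompletion L) := isUnit_placeForm_antidiagonal_unit_mem_glInt (E := L) (N := 3) w.1 hΦw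
  have hJ0m : ((hΦw.unit : GL (Fin 3) (w.1.adicCompletion L)) : Matrix (Fin 3) (Fin 3) (w.1.adicCompletion L)) =
      (StdForm.antidiagonal 3).over (w.1.adicCompletion L) := by rw [IsUnit.unit_spec, placeForm_antidiagonal]
  have hJh : (((hΦw.unit : GL (Fin 3) (w.1.adicCompletion L)) : Matrix (Fin 3) (Fin 3) (w.1.adicCompletion L)).map σ)ᵀ = hΦw.unit := by
    rw [hJ0m, StdForm.over_map, StdForm.transpose_over]
  have hL₀ : IsSelfDualLattice σ (toPlace v w k₀) ((hΦw.unit : GL (Fin 3) (w.1.adicCompletion L)) : Matrix (Fin 3) (Fin 3) (w.1.adicCompletion L))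
      (stdLattice (w.1.adicCompletion L) 3) := by
    rw [hJ0m]; exact isSelfDualLattice_stdLattice_three_of_v hϖk
  have htrace : ∃ t : w.1.adicCompletion L, Valued.v t ≤ 1 ∧ t + σ t = 1 := by
    let σO := (galAdicCompletionMap (L := L) (IsCMField.complexConj L) hw).restrict (ValuativeRel.valuation (w.1.adicCompletion L)).integer _
      fun x hx => galAdicCompletionMap_mem_integer (IsCMField.complexConj L) w hw hx
    obtain ⟨t, ht1⟩ := exists_add_map_eq_one_integer (IsCMField.complexConj L) w hc1 hw hv σO (fun _ => rfl) fun x => Subtype.ext (hσσ x)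
    exact ⟨t, (v_le_one_iff_mem_integer (t : w.1.adicCompletion L)).2 t.2, congrArg Subtype.val ht1⟩
  have htrans : ∀ Λ : Submodule (Valued.integer (w.1.adicCompletion L)) (Fin 3 → w.1.adicCompletion L),
      IsSelfDualLattice σ (toPlace v w k₀) ((hΦw.unit : GL (Fin 3) (w.1.adicCompletion L)) : Matrix (Fin 3) (Fin 3) (w.1.adicCompletion L)) Λ →
        ∃ g₁ : ↥(unitaryGroupOfForm σ ((hΦw.unit : GL (Fin 3) (w.1.adicCompletion L)) : Matrix (Fin 3) (Fin 3) (w.1.adicCompletion L))),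
          Λ = mapGL ((g₁ : ↥(unitaryGroupOfForm σ ((hΦw.unit : GL (Fin 3) (w.1.adicCompletion L)) : Matrix (Fin 3) (Fin 3) (w.1.adicCompletion L)))) :
            GL (Fin 3) (w.1.adicCompletion L)) (stdLattice (w.1.adicCompletion L) 3) := by
    rw [hJ0m]
    intro Λ hΛ
    obtain ⟨g₁, hg₁⟩ := exists_unitary_mapGL_stdLattice_eq_of_isSelfDualLattice_of_trace hσσ hvσ hϖk htrace hΛ
    exact ⟨g₁, hg₁.symm⟩
  -- ### (3) the block frame: `φ_b(g_w, u_w) = T δ_w T⁻¹` (★ (O-5)-place at `c`, then conjugation by `T`)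
  set cw : GL (Fin 3) (w.1.adicCompletion L) := Units.map (RingHom.mapMatrix ev).toMonoidHom cj with hcw
  have hcwval : (cw : Matrix (Fin 3) (Fin 3) (w.1.adicCompletion L)) = ((cj : GL (Fin 3) (LocalRing L v)) : Matrix (Fin 3) (Fin 3) (LocalRing L v)).map ev := rfl
  have hcfr' : cfr = T * cw := Units.ext (by rw [Units.val_mul, hcwval, hcfr])
  obtain ⟨φ₀, hφ₀, hφ₀w⟩ := exists_algHom_blockFrame_apply_eq_of_conj_place L H' w γH hcj
  have hframe : φb (((γH.1.val : GL (Fin 2) (LocalRing L v)).val.map ev), finGammaTwo L v γH w) =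
      (T : Matrix (Fin 3) (Fin 3) (w.1.adicCompletion L)) *
        ((δ.val : GL (Fin 3) (LocalRing L v)) : Matrix (Fin 3) (Fin 3) (LocalRing L v)).map ev *
        ((T⁻¹ : GL (Fin 3) (w.1.adicCompletion L)) : Matrix (Fin 3) (Fin 3) (w.1.adicCompletion L)) := by
    have e1 := hφ₀ (((γH.1.val : GL (Fin 2) (LocalRing L v)).val.map ev)) (finGammaTwo L v γH w)
    rw [hφ₀w] at e1
    rw [hφb, hcfr', _root_.mul_inv_rev, Units.val_mul, Units.val_mul, e1]
    simp only [Matrix.mul_assoc]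
    rfl
  -- ### (4) the eigenvector `p′ = c e₃` of `δ`, its `H′_v`-value `x₀ ∈ L⁺_v`, `x₀ ≠ 0`, and the κ-reading
  obtain ⟨δ₁, hcδ, hδ₁⟩ := Literature.NumberTheory.Weil1982.UnitaryFinTopForm.exists_complexConj_eq_neg_ne_zero L
  have hF := Liu2021.LemD1IndexedNonVacuityNonsplitPlace.isField_localRing_of_nonsplit L v (IsCMField.complexConj L) hcδ hδ₁ w hw
  letI : Field (UnitaryGroup.LocalRing L v) := hF.toField
  have hA : Irreducible ((γH.1.val : GL (Fin 2) (UnitaryGroup.LocalRing L v)).val.charpoly) :=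
    irreducible_charpoly_of_not_exists_isRoot_eval L v w hw _ hirr
  have hA' : ∀ r : UnitaryGroup.LocalRing L v, (γH.1.val : GL (Fin 2) (UnitaryGroup.LocalRing L v)).val.charpoly.eval r ≠ 0 :=
    Literature.LinearAlgebra.Matrix.eval_charpoly_ne_zero_of_irreducible hA (by simp)
  have hu : IsUnit ((finCharpolyTwo L v γH).eval (finGammaTwo L v γH)) := by
    obtain ⟨y, hy⟩ := hF.mul_inv_cancel (hA' (finGammaTwo L v γH))
    exact IsUnit.of_mul_eq_one _ hy
  have hH'c : (H'.map (cmConjRingHom L))ᵀ = H' := by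
    have e1 : H'.map (cmConjRingHom L) = H'.map (IsCMField.complexConj L) := by
      ext i j; simp [Matrix.map_apply, cmConjRingHom_apply]
    rw [e1]; exact hH'
  have hσσv : ∀ s, UnitaryGroup.conjLocal L (IsCMField.complexConj L) v (UnitaryGroup.conjLocal L (IsCMField.complexConj L) v s) = s :=
    Liu2021.LemD1OfPlace.conjLocal_conjLocal_apply L v (IsCMField.complexConj L) hcδ hδ₁
  have hH := UnitaryGroup.map_conjLocal_transpose_localForm L 3 H' v hH'c
  have hHd := UnitaryGroup.isUnit_det_localForm L 3 H' v (Matrix.isUnit_iff_isUnit_det _ |>.1 hH'u).ne_zero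
  have hfr := mul_eq_mul_reindex_fromBlocks_of_conj_endoEmbLocal_eq L H' γH hcj
  set p' : Fin 3 → UnitaryGroup.LocalRing L v := fun i => cj.val i (endoPerm (Sum.inr 0)) with hp'def
  have hp' : (δ.val.val : Matrix (Fin 3) (Fin 3) (UnitaryGroup.LocalRing L v)) *ᵥ p' = finGammaTwo L v γH • p' :=
    mulVec_col_eq_smul_of_blockFrame endoPerm hfr
  have hne : p' ≠ 0 := by
    intro h0
    apply (Matrix.isUnits_det_units cj).ne_zero
    exact Matrix.det_eq_zero_of_column_eq_zero (endoPerm (Sum.inr 0)) fun i => congrFun h0 i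
  obtain ⟨x₀, hx₀⟩ := exists_toLocalRing_eq_formValue L v H' hH'c p'
  have hval0 : (∑ i : Fin 3, ∑ k : Fin 3, UnitaryGroup.conjLocal L (IsCMField.complexConj L) v (p' i) *
      ((UnitaryGroup.adelicForm L 3 H').map (UnitaryGroup.adeleToLocal L v)) i k * p' k) ≠ 0 := by
    obtain ⟨G₁, g₃, hTw, -, -⟩ := twistGram_blockFrame_eq (UnitaryGroup.conjLocal L (IsCMField.complexConj L) v) endoPerm _ hσσv δ.2 hfr hA'
    obtain ⟨-, -, -, hg₃0⟩ := blockFrame_gram_hermitian (UnitaryGroup.conjLocal L (IsCMField.complexConj L) v) endoPerm _ hσσv hH hHd.ne_zero hTw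
    rw [← twistGram_apply_self_eq_formValue, hTw, blockFrame_apply_corner]
    exact hg₃0
  have hx₀0 : x₀ ≠ 0 := fun h0 => hval0 (by rw [← hx₀, h0, map_zero])
  have hvx₀0 : Valued.v x₀ ≠ 0 := (Valuation.ne_zero_iff _).2 hx₀0
  have hite := finKappaAt_eq_ite_even_of_nonsplit_of_isUnramifiedIn L v H' γH δ w hw hv h hu hp' hne x₀ hx₀0 hx₀
  -- ### (5) the token vector `c_fr e₃ = T (c e₃)_w` and its `J₀`-value `ι_w x₀`
  set pw : Fin 3 → w.1.adicCompletion L := fun i => p' i w with hpw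
  have hcol : (cfr : Matrix (Fin 3) (Fin 3) (w.1.adicCompletion L)) *ᵥ Pi.single (endoPerm (Sum.inr 0)) (1 : w.1.adicCompletion L) =
      (T : Matrix (Fin 3) (Fin 3) (w.1.adicCompletion L)) *ᵥ pw := by
    rw [Matrix.mulVec_single_one, hcfr]
    ext i
    simp only [Matrix.col_apply, Matrix.mul_apply, Matrix.mulVec, dotProduct, Matrix.map_apply, hpw, hp'def]
    rfl
  have hvalue : dotProduct (fun i => σ (((cfr : Matrix (Fin 3) (Fin 3) (w.1.adicCompletion L)) *ᵥ Pi.single (endoPerm (Sum.inr 0)) (1 : w.1.adicCompletion L)) i))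
      ((StdForm.antidiagonal 3).over (w.1.adicCompletion L) *ᵥ ((cfr : Matrix (Fin 3) (Fin 3) (w.1.adicCompletion L)) *ᵥ
        Pi.single (endoPerm (Sum.inr 0)) (1 : w.1.adicCompletion L))) = toPlace v w x₀ := by
    have key : ∀ (A : Matrix (Fin 3) (Fin 3) (w.1.adicCompletion L)) (q : Fin 3 → w.1.adicCompletion L),
        dotProduct (fun i => σ (q i)) (A *ᵥ q) = ∑ i, ∑ k, σ (q i) * A i k * q k := by
      intro A q
      simp only [dotProduct, Matrix.mulVec, Finset.mul_sum, mul_assoc]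
    rw [key, hcol, sum_map_mulVec_mul_mulVec_eq_of_formCongr_eq σ T hJT.symm pw]
    have e2 := congrFun hx₀ w
    rw [UnitaryGroup.toLocalRing_apply] at e2
    rw [e2]
    simp only [Finset.sum_apply, Pi.mul_apply, hpw]
    refine Finset.sum_congr rfl fun i _ => Finset.sum_congr rfl fun k _ => ?_
    rw [conjLocal_apply_eq_galAdicCompletionMap L v w hw, UnitaryGroup.adelicForm_map_adeleToLocal, Matrix.map_apply]
    rfl
  -- the token in ★ F5-(0)'s `ValuativeRel` currency ⟺ `|z|²|x₀| = 1` ⟺ (§1) `ord_v x₀` even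
  have htoken : ∀ z : w.1.adicCompletion L, valuation (w.1.adicCompletion L) (σ z * z * toPlace v w x₀) = 1 ↔ Valued.v z ^ 2 * Valued.v x₀ = 1 := fun z => by
    rw [← v_eq_one_iff_valuation_eq_one, map_mul, map_mul, hvσ, hιv, sq]
  have hpar := exists_ne_zero_and_valuation_sq_mul_eq_one_iff_even_log hϖ hvx₀0
  -- ### (6) the Eisenstein letters in ★ F5-(0)'s `ι_w k₀`-currency; integrality of `g_w`, `u_w`
  have hΘd' : Valued.v Θ.det = Valued.v (toPlace v w k₀) := by rw [hΘd, hϖ, hϖk]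
  have hb' : Valued.v b = Valued.v (toPlace v w k₀) ^ N := by rw [hb, hϖ, hϖk]
  have hn' : Valued.v (finGammaTwo L v γH w • (1 : Matrix (Fin 2) (Fin 2) (w.1.adicCompletion L)) -
      (γH.1.val : GL (Fin 2) (LocalRing L v)).val.map ev).det = Valued.v (toPlace v w k₀) ^ n := by
    have e1 : (finGammaTwo L v γH w • (1 : Matrix (Fin 2) (Fin 2) (w.1.adicCompletion L)) - (γH.1.val : GL (Fin 2) (LocalRing L v)).val.map ev).det =
        ((finCharpolyTwo L v γH).eval (finGammaTwo L v γH)) w := by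
      rw [eval_finCharpolyTwo_finGammaTwo, Matrix.det_fin_two]
      simp only [hev, Pi.evalRingHom_apply, Pi.add_apply, Pi.sub_apply, Pi.mul_apply, Matrix.trace_fin_two, Matrix.det_fin_two, Matrix.sub_apply,
        Matrix.smul_apply, Matrix.map_apply, Matrix.one_apply_eq, Matrix.one_apply_ne (by decide : (0 : Fin 2) ≠ 1),
        Matrix.one_apply_ne (by decide : (1 : Fin 2) ≠ 0), smul_eq_mul, mul_one, mul_zero]
      ring
    rw [e1, hn, hϖk, ← WithZero.exp_nsmul]
    simp
  have hO1 : ∀ x : w.1.adicCompletion L, Valued.v (x - 1) ≤ WithZero.exp (-1 : ℤ) → x ∈ 𝒪[w.1.adicCompletion L] := fun x hx => by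
    have hx1 : x - 1 ∈ 𝒪[w.1.adicCompletion L] := (v_le_one_iff_mem_integer _).1 (hx.trans (WithZero.exp_le_exp.2 (by norm_num) |>.trans_eq WithZero.exp_zero))
    simpa only [sub_add_cancel] using add_mem hx1 (one_mem 𝒪[w.1.adicCompletion L])
  have hg : ∀ i j, ((γH.1.val : GL (Fin 2) (LocalRing L v)).val.map ev) i j ∈ 𝒪[w.1.adicCompletion L] := fun i j => by
    by_cases hij : i = j
    · subst hij; exact hO1 _ (by simpa only [Matrix.sub_apply, Matrix.one_apply_eq] using hg1 i i)
    · have h1 := hg1 i j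
      rw [Matrix.sub_apply, Matrix.one_apply_ne hij, sub_zero] at h1
      exact (v_le_one_iff_mem_integer _).1 (h1.trans (WithZero.exp_le_exp.2 (by norm_num) |>.trans_eq WithZero.exp_zero))
  have hu' : finGammaTwo L v γH w ∈ 𝒪[w.1.adicCompletion L] := hO1 _ hu1
  -- ### (7) the two classes
  rw [htot]
  split_ifs with hκ
  · -- CLASS I: `κ = 1` ⇒ `ord_v x₀` even ⇒ the token holds
    have heven : Even (WithZero.log (Valued.v x₀)) := by
      by_contra hodd; rw [hκ, if_neg hodd] at hite; norm_num at hite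
    obtain ⟨z, hz0, hz⟩ := hpar.2 heven
    have hF5 := ncard_isSelfDualLattice_stable_eq_phiTHn_inertPlace (IsCMField.complexConj L) v hc1 hv w hw w₁ haF hk₀ s' hθ hθv hcoord hint hs'ι hs'θ hs's'
      hs'O hs'v hnorm1 hΦw.unit hJ hJh hL₀ htrans cfr φb hφb φ hφ (fun b₁ => by rw [hJ0m]; exact hstar b₁) hg hu' hΘ hΘd' hΘt hrel hn' hb' hlam hφx hK hall hcoordlam P hP hPx
      (by rw [hJ0m]; exact hgateV) ⟨z, hz0, by rw [hJ0m, hvalue]; exact (htoken z).2 hz⟩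
    rw [hJ0m, hframe] at hF5
    exact hF5
  · -- CLASS II: `κ = −1` ⇒ `ord_v x₀` odd ⇒ the token fails for every `z ≠ 0`
    have hκ' : finKappaAt L v H' γH δ = -1 := (finKappaAt_eq_one_or_eq_neg_one_of_isUnit L v H' γH δ h hu).resolve_left hκ
    have hodd : ¬ Even (WithZero.log (Valued.v x₀)) := by
      intro heven; rw [hκ', if_pos heven] at hite; norm_num at hite
    have hF5 := ncard_isSelfDualLattice_stable_eq_phiTHprimen_inertPlace (IsCMField.complexConj L) v hc1 hv w hw w₁ haF hk₀ s' hθ hθv hcoord hint hs'ι hs'θ hs's'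
      hs'O hs'v hnorm1 hΦw.unit hJ hJh hL₀ htrans cfr φb hφb φ hφ (fun b₁ => by rw [hJ0m]; exact hstar b₁) hg hu' hΘ hΘd' hΘt hrel hn' hb' hlam hφx hK hall hcoordlam P hP hPx
      (by rw [hJ0m]; exact hgateV) (fun z hz0 hz => hodd (hpar.1 ⟨z, hz0, (htoken z).1 (by rw [hJ0m, hvalue] at hz; exact hz)⟩))
    rw [hJ0m, hframe] at hF5
    exact hF5

include hH' hv hH'u hreg hirr h ht hcj hTint hJT haF hk₀ hθ hθv hcoord hint hs'ι hs'θ hs's' hs'O hs'v hnorm1 hcfr hφb hφ hstar hϖ hΘ hΘd hΘt hrel hn hb hg1 hu1 hlam hφx hK hall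
  hcoordlam hP hPx hgateV in
set_option maxHeartbeats 400000 in
open scoped Classical in
/-- **(B2b-II), CLASS I: `n₀(δ) + n₁(δ) + n₂(δ) = Φ_n(N) = phiTHn q n N` for a deep type-(2) match with `κ_v(γ_H, δ) = +1`**, at an integral frame `T` of `H′_w` and the block
frame `c_fr = T·c_w`, over the (B3) head's Eisenstein letters and ★ F5-(0)'s row-∕pair-level block (see the module docstring); `q = #𝓀(L⁺_v)`.
[cite: Rogawski1990, §4.9 Lemma 4.9.3 p. 56, Prop. 4.9.1 (b) p. 55] [cite: Kottwitz1986BaseChangeUnits, §1 pp. 240–241] [cite: Flicker1998UnitaryFL, Prop. 11 p. 87; Theorem 18 p. 97] -/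
theorem sum_ncard_rankStrata_eq_phiTHn_of_frame_of_finKappaAt_eq_one (hκ : finKappaAt L v H' γH δ = 1) :
    (({q : (cmDatum L 3 H').Local v ⧸ cmLocalIntegralLevel L 3 H' v |
            q ∈ MulAction.fixedBy ((cmDatum L 3 H').Local v ⧸ cmLocalIntegralLevel L 3 H' v) δ ∧
              (redMat ((((q.out⁻¹ * δ * q.out : (cmDatum L 3 H').Local v)).val : GL (Fin 3) (LocalRing L v)).val.map
                (Pi.evalRingHom (fun w' : UnitaryGroup.PlacesOver L v => w'.1.adicCompletion L) w)) - 1).rank = 0}.ncard +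
        {q : (cmDatum L 3 H').Local v ⧸ cmLocalIntegralLevel L 3 H' v |
            q ∈ MulAction.fixedBy ((cmDatum L 3 H').Local v ⧸ cmLocalIntegralLevel L 3 H' v) δ ∧
              (redMat ((((q.out⁻¹ * δ * q.out : (cmDatum L 3 H').Local v)).val : GL (Fin 3) (LocalRing L v)).val.map
                (Pi.evalRingHom (fun w' : UnitaryGroup.PlacesOver L v => w'.1.adicCompletion L) w)) - 1).rank = 1}.ncard +
        {q : (cmDatum L 3 H').Local v ⧸ cmLocalIntegralLevel L 3 H' v |
            q ∈ MulAction.fixedBy ((cmDatum L 3 H').Local v ⧸ cmLocalIntegralLevel L 3 H' v) δ ∧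
              (redMat ((((q.out⁻¹ * δ * q.out : (cmDatum L 3 H').Local v)).val : GL (Fin 3) (LocalRing L v)).val.map
                (Pi.evalRingHom (fun w' : UnitaryGroup.PlacesOver L v => w'.1.adicCompletion L) w)) - 1).rank = 2}.ncard : ℕ) : ℚ) =
      phiTHn (Nat.card 𝓀[v.adicCompletion ↥(maximalRealSubfield L)]) n N := by
  have key := sum_ncard_rankStrata_eq_and_token_iff hH' w hw hv hH'u hreg hirr δ h ht hcj T hTint hJT w₁ haF hk₀ s' hθ hθv hcoord hint hs'ι hs'θ hs's' hs'O hs'v hnorm1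
    cfr hcfr φb hφb φ hφ hstar hϖ hΘ hΘd hΘt hrel n N hn hb hg1 hu1 hlam hφx hK hall hcoordlam P hP hPx hgateV
  rwa [if_pos hκ] at key

include hH' hv hH'u hreg hirr h ht hcj hTint hJT haF hk₀ hθ hθv hcoord hint hs'ι hs'θ hs's' hs'O hs'v hnorm1 hcfr hφb hφ hstar hϖ hΘ hΘd hΘt hrel hn hb hg1 hu1 hlam hφx hK hall
  hcoordlam hP hPx hgateV in
set_option maxHeartbeats 400000 in
open scoped Classical in
/-- **(B2b-II), CLASS II: `n₀(δ) + n₁(δ) + n₂(δ) = Φ′_n(N) = phiTHprimen q n N` for a deep type-(2) match with `κ_v(γ_H, δ) = −1`** (same frame, same letters).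
[cite: Rogawski1990, §4.9 Lemma 4.9.3 p. 56, Prop. 4.9.1 (b) p. 55] [cite: Kottwitz1986BaseChangeUnits, §1 pp. 240–241] [cite: Flicker1998UnitaryFL, Props. 16–17 pp. 96–97; Theorem 18 p. 97] -/
theorem sum_ncard_rankStrata_eq_phiTHprimen_of_frame_of_finKappaAt_eq_neg_one (hκ : finKappaAt L v H' γH δ = -1) :
    (({q : (cmDatum L 3 H').Local v ⧸ cmLocalIntegralLevel L 3 H' v |
            q ∈ MulAction.fixedBy ((cmDatum L 3 H').Local v ⧸ cmLocalIntegralLevel L 3 H' v) δ ∧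
              (redMat ((((q.out⁻¹ * δ * q.out : (cmDatum L 3 H').Local v)).val : GL (Fin 3) (LocalRing L v)).val.map
                (Pi.evalRingHom (fun w' : UnitaryGroup.PlacesOver L v => w'.1.adicCompletion L) w)) - 1).rank = 0}.ncard +
        {q : (cmDatum L 3 H').Local v ⧸ cmLocalIntegralLevel L 3 H' v |
            q ∈ MulAction.fixedBy ((cmDatum L 3 H').Local v ⧸ cmLocalIntegralLevel L 3 H' v) δ ∧
              (redMat ((((q.out⁻¹ * δ * q.out : (cmDatum L 3 H').Local v)).val : GL (Fin 3) (LocalRing L v)).val.map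
                (Pi.evalRingHom (fun w' : UnitaryGroup.PlacesOver L v => w'.1.adicCompletion L) w)) - 1).rank = 1}.ncard +
        {q : (cmDatum L 3 H').Local v ⧸ cmLocalIntegralLevel L 3 H' v |
            q ∈ MulAction.fixedBy ((cmDatum L 3 H').Local v ⧸ cmLocalIntegralLevel L 3 H' v) δ ∧
              (redMat ((((q.out⁻¹ * δ * q.out : (cmDatum L 3 H').Local v)).val : GL (Fin 3) (LocalRing L v)).val.map
                (Pi.evalRingHom (fun w' : UnitaryGroup.PlacesOver L v => w'.1.adicCompletion L) w)) - 1).rank = 2}.ncard : ℕ) : ℚ) =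
      phiTHprimen (Nat.card 𝓀[v.adicCompletion ↥(maximalRealSubfield L)]) n N := by
  have key := sum_ncard_rankStrata_eq_and_token_iff hH' w hw hv hH'u hreg hirr δ h ht hcj T hTint hJT w₁ haF hk₀ s' hθ hθv hcoord hint hs'ι hs'θ hs's' hs'O hs'v hnorm1
    cfr hcfr φb hφb φ hφ hstar hϖ hΘ hΘd hΘt hrel n N hn hb hg1 hu1 hlam hφx hK hall hcoordlam P hP hPx hgateV
  rwa [if_neg (by rw [hκ]; norm_num)] at key

end Frame

end Literature.NumberTheory.Rogawski1990

end
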